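import Summits.Ventures.YMGap.YM3IR.Clustering
import Summits.Ventures.YMGap.Thresholds.StarDimRows
import Summits.Ventures.YMGap.Thresholds.StarMassGapDimRows
import HarnessLib

/-!
# YM₃ infrared statement — the STRONG-COUPLING END of the clustering currency as a kernel theorem:
# `UniformClustering suFrobDist (wilsonFamily3 (fundamentalRep (Fin N)) β) m` for every `SU(N)`, `N ≥ 2`,
# at every tree coupling `|β| ≤ 2N/45` (and `SU(2)` at `|β| ≤ 5/18`), from the vertex-star Dobrushin door

HONEST FRAMING: venture file of the cell `pub-ymgap` (QuantumFields programme; seat ds-1, for track Y4).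
Strong-coupling LATTICE statements only — the STRONG-COUPLING END OF THE CURRENCY: exponential clustering of the
finite-volume Wilson laws of `SU(N)` lattice gauge theory on the tori `(ℤ/M)^d`, uniformly in the side `M ≥ 3`,
at SMALL coupling `|β|`, with an explicit (tiny) Dobrushin rate.  It does NOT touch the weak-coupling targets
`YM3IR.LatticeMassGap3` / `YM3IR.MassGap3` (part 1) or `LatticeMassGap3Cofinal` / `MassGap3Cofinal` (part 2) —
all about LARGE `β` —, says nothing about the continuum, and is not a Clay-problem statement.  No new definition;
`0` compute.

COUPLING CONVENTION.  `β` below is the TREE coupling of `wilsonMeasure (fundamentalRep (Fin N)) β` (plaquette weight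
`exp(−β(N − Re tr U_p))`), i.e. `β = β_W/N` for the standard Wilson `β_W = 2N/g₀²` and `β = N·x` for the 't Hooft
coupling `x` of the cell's `MassGapAt d N x` rows — the convention of `YM3IR.wilsonFamily3` (docstring there; as a
LEMMA: `YM3IR.CarrierBridge.wilsonAction_configEquiv` / `betaTree_eq`, ym3ir-theory-1).  So `|β| ≤ 2N/45` below is
't Hooft `|x| ≤ 2/45`, Wilson `|β_W| ≤ 2N²/45`; for `SU(2)`, `|β| ≤ 5/18` is `|β_W| ≤ 5/9`.

WHAT.  Track Y4's currency (`YM3IR/Clustering.lean`, ym3ir-theory-2) is `YM3IR.ClustersWith r μ A m`: for bounded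
measurable cylinder observables `f, g` of the links in `Δf, Δg`, coordinatewise `r`-Lipschitz with constants
`δf, δg` (Föllmer's `DobrushinMetric.IsLipBound`), base points `≥ n` apart in the periodic sup-norm,
`|cov_μ(f,g)| ≤ A (Σδf)(Σδg) e^{−mn}`; `YM3IR.UniformClustering r fam m` asks one `A` for all tori of side
`M ≥ 3`.  Its docstrings record the strong-coupling case as «known IN PRINT (Osterwalder–Seiler 1978 §3; the
cell's certified windows)».  The tree already HAS it as a kernel theorem in the neighbouring currency: ds-4's
general-(`d`,`N`) vertex-star door `StarDimRows.abs_covariance_le_of_oneLinkKRModulus` (Lemma G + the tree's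
Dobrushin–Shlosman comparison theorem `DobrushinShlosman.abs_covariance_le`) bounds torus covariances of
`DSWindow.LinkObs` observables — and `LinkObs suFrobDist f Δ δ` is field-for-field the hypothesis list of
`ClustersWith` (measurable, bounded, `DependsOn`, nonnegative coordinatewise Lipschitz bounds), with the
ENDPOINT distance `≥ n − 2` in place of the base-point distance `≥ n`.  This file is the plumbing:

* `decayRate_anti`, `gaugeR_mono` — the Dobrushin rate `κ_d(ρ) = (1−ρ)²/(2(4dρ+1))` decreases in `ρ` and the
  star received sum `R_G^{(d)}(c)` increases in `c` below the door, so ONE closed-form rate serves a whole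
  coupling window;
* ★ `clustersWith_wilson_of_oneLinkKRModulus` — any `d ≥ 2`, `N ≥ 1`, side `L ≥ 3`: a one-link modulus
  `OneLinkKRModulus N R K` on the tilt ball `R ≥ 2(d−1)|β|/N`, `K|β|/N ≤ c̄` and the door `P_d(c̄) < 1` give
  `ClustersWith suFrobDist (wilsonMeasure (fundamentalRep (Fin N)) β) (16 N e^{2m̄}) m̄`,
  `m̄ = κ_d(R_G^{(d)}(c̄))`; ★ `uniformClustering_wilson_of_oneLinkKRModulus` — the same for the whole family
  of tori (`UniformClustering`), every `d`;
* every `SU(N)`, `N ≥ 2`, every `d ≥ 2`, HYPOTHESIS-FREE (Bakry–Émery modulus `oneLinkKRModulus_SU`):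
  `uniformClustering_wilson_SU_of_abs_le : |β|/N·(d−1) ≤ 1/12 → UniformClustering suFrobDist (fun M _ =>
  wilsonMeasure (d := d) (L := M) (fundamentalRep (Fin N)) β) (κ_d(R_G^{(d)}(1/(4(d−1)))))`;
* ★ `d = 3` IN TRACK Y4's VOCABULARY: `uniformClustering_wilsonFamily3_SU (hN : 2 ≤ N) (h : |β| ≤ 2N/45) :
  UniformClustering suFrobDist (wilsonFamily3 (fundamentalRep (Fin N)) β) (κ_3(R_G^{(3)}(4/29)))` — every
  `SU(N)`, two-sided ('t Hooft `|β|/N ≤ 2/45`, the all-`N` `d = 3` star row of `StarMassGapDimRows`; Wilson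
  `|β_W| ≤ 2N²/45`), and `uniformClustering_wilsonFamily3_SU2 (h : |β| ≤ 5/18)` (`SU(2)`, Wilson `|β_W| ≤ 5/9`,
  quarter modulus); both with `0 < m` recorded (`StarDimLimit.dimRate_pos`).
So YM-PROMISE §E may say: the IR target's currency is INHABITED at strong coupling by a kernel theorem for every
`N ≥ 2` (class K), not only in print.  The rate is the Dobrushin comparison rate (`≈ 4·10⁻⁵` at the edge of the
window, `→ 1/2` as `β → 0`) — no physical mass is claimed.

References: Osterwalder–Seiler, Ann. Phys. 110 (1978) §3 (strong-coupling clustering, the printed statement);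
Dobrushin–Shlosman (1985) `C_V`; Föllmer, LNM 1362 (1988) Ch. I (2.17)–(2.21); cell files
STAR-DIMENSIONS(-K).md (ds-4), YM3-IR.md (ym3ir-theory-1/2).
-/

noncomputable section

open MeasureTheory ProbabilityTheory Finset
open Literature.Probability.LatticeModels Literature.Probability.LatticeModels.DobrushinMetric
open Literature.MathematicalPhysics.QuantumLattice (fundamentalRep)
open Literature.MathematicalPhysics.QuantumFieldTheory
open Literature.MathematicalPhysics.QuantumFieldTheory.Balaban1983to89.StrongCouplingDobrushinWindow
  (OneLinkKRModulus)
open Literature.MathematicalPhysics.QuantumFieldTheory.Balaban1983to89.StrongCouplingKernelWindow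
  (oneLinkKRModulus_SU)
open Summit.Ventures.YMGap.DSWindow (LinkObs linkEnds torusNorm_fst_sub_linkEnds_le_one)
open Summit.Ventures.YMGap.StarResolventDim

namespace Summit.Ventures.YMGap.YM3IR.StrongCoupling

variable {d N : ℕ}

/-! ### Two monotonicity lemmas: one rate for a whole coupling window -/

/-- The Dobrushin comparison rate `κ_d(ρ) = (1−ρ)²/(2(2ρ·2d+1))` is antitone in the received sum
`ρ ∈ [0, 1]`. [folklore] -/
theorem decayRate_anti {ρ ρ' : ℝ} (h0 : 0 ≤ ρ') (hle : ρ' ≤ ρ) (h1 : ρ ≤ 1) :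
    (1 - ρ) ^ 2 / (2 * (2 * ρ * ((2 * d : ℕ) : ℝ) + 1)) ≤
      (1 - ρ') ^ 2 / (2 * (2 * ρ' * ((2 * d : ℕ) : ℝ) + 1)) := by
  have hd0 : (0 : ℝ) ≤ ((2 * d : ℕ) : ℝ) := Nat.cast_nonneg _
  have hpos' : 0 < 2 * (2 * ρ' * ((2 * d : ℕ) : ℝ) + 1) := by positivity
  refine div_le_div₀ (sq_nonneg _) ?_ hpos' ?_
  · nlinarith
  · nlinarith [mul_le_mul_of_nonneg_right hle hd0]

/-- The star received sum `R_G^{(d)}(c) = (2d−2)c(1+c)/Δ_d(c)` is monotone in `c` on the door region: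
`0 ≤ c' ≤ c`, `P_d(c) < 1` (`d ≥ 2`) give `R_G^{(d)}(c') ≤ R_G^{(d)}(c)` (numerator increasing, `Δ_d`
decreasing and positive). [folklore] -/
theorem gaugeR_mono (hd : 2 ≤ d) {c c' : ℝ} (h0 : 0 ≤ c') (hle : c' ≤ c) (h : doorPoly d c < 1) :
    gaugeR d c' ≤ gaugeR d c := by
  have hd' : (2 : ℝ) ≤ d := by exact_mod_cast hd
  have hc0 : 0 ≤ c := h0.trans hle
  have hΔ : 0 < Delta d c := Delta_pos_of_door hd hc0 h
  unfold gaugeR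
  refine div_le_div₀ (mul_nonneg (mul_nonneg (by linarith) hc0) (by linarith)) ?_ hΔ ?_
  · have h1 : (2 * (d : ℝ) - 2) * c' ≤ (2 * (d : ℝ) - 2) * c := mul_le_mul_of_nonneg_left hle (by linarith)
    exact mul_le_mul h1 (by linarith) (by linarith) (mul_nonneg (by linarith) hc0)
  · unfold Delta
    nlinarith [mul_le_mul hle hle h0 hc0, mul_nonneg (by linarith : (0 : ℝ) ≤ 2 * d - 4) (sub_nonneg.2 hle),
      mul_nonneg (by linarith : (0 : ℝ) ≤ 2 * d - 2) (sub_nonneg.2 (mul_le_mul hle hle h0 hc0))]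

/-! ### The socket: torus clustering in the Y4 currency from a one-link modulus, every dimension -/

section Torus

variable {L : ℕ} [NeZero L]

/-- **`ClustersWith` for the torus Wilson law from a one-link modulus, dimension `d`** (`SU(N)`, `N ≥ 1`,
`d ≥ 2`, side `L ≥ 3`, tree coupling `β`): a modulus `OneLinkKRModulus N R K` (`K ≥ 0`) on the tilt ball
`R ≥ 2(d−1)|β|/N`, a ceiling `K|β|/N ≤ c̄` and the door `P_d(c̄) < 1` give
`YM3IR.ClustersWith suFrobDist (wilsonMeasure β) (16 N e^{2m̄}) m̄` with the closed-form rate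
`m̄ = (1−ρ̄)²/(2(4dρ̄+1))`, `ρ̄ = R_G^{(d)}(c̄)` — ds-4's `StarDimRows.abs_covariance_le_of_oneLinkKRModulus` read
through `LinkObs ↔ (Measurable, bounded, DependsOn, IsLipBound)` and «base points `≥ n` apart ⇒ endpoints
`≥ n − 2` apart» (the factor `e^{2m̄}`). [folklore] -/
theorem clustersWith_wilson_of_oneLinkKRModulus (hd : 2 ≤ d) (hL : 3 ≤ L) (hN : 1 ≤ N) {β R K c : ℝ}
    (hK0 : 0 ≤ K) (hR : |β| / N * (2 * ((d : ℝ) - 1)) ≤ R) (hmod : OneLinkKRModulus N R K)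
    (hc : K * (|β| / N) ≤ c) (h : doorPoly d c < 1) :
    YM3IR.ClustersWith suFrobDist (wilsonMeasure (d := d) (L := L) (fundamentalRep (Fin N)) β)
      (16 * N * Real.exp (2 * ((1 - gaugeR d c) ^ 2 / (2 * (2 * gaugeR d c * ((2 * d : ℕ) : ℝ) + 1)))))
      ((1 - gaugeR d c) ^ 2 / (2 * (2 * gaugeR d c * ((2 * d : ℕ) : ℝ) + 1))) := by
  intro f g Δf Δg δf δg n hfm hgm hfd hgd hfb hgb hfl hgl hdist
  -- names
  set c₀ : ℝ := K * (|β| / N) with hc₀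
  set ρ₀ : ℝ := gaugeR d c₀ with hρ₀
  set ρ : ℝ := gaugeR d c with hρ
  set m₀ : ℝ := (1 - ρ₀) ^ 2 / (2 * (2 * ρ₀ * ((2 * d : ℕ) : ℝ) + 1)) with hm₀
  set m : ℝ := (1 - ρ) ^ 2 / (2 * (2 * ρ * ((2 * d : ℕ) : ℝ) + 1)) with hm
  have hc00 : 0 ≤ c₀ := mul_nonneg hK0 (by positivity)
  have h₀ : doorPoly d c₀ < 1 := doorPoly_lt_one_mono hd hc00 hc h
  obtain ⟨hρ00, hρ01⟩ := gaugeR_lt_one_of_door hd hc00 h₀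
  obtain ⟨hρ0', hρ1'⟩ := gaugeR_lt_one_of_door hd (hc00.trans hc) h
  have hρle : ρ₀ ≤ ρ := gaugeR_mono hd hc00 hc h
  have hmle : m ≤ m₀ := decayRate_anti hρ00 hρle hρ1'.le
  have hm0 : 0 ≤ m := (StarDimLimit.dimRate_pos (d := d) hρ0' hρ1').le
  -- the observables are admissible link observables
  have hf : LinkObs suFrobDist f Δf δf := ⟨hfm, hfb, hfd, hfl.nonneg, hfl.le⟩
  have hg : LinkObs suFrobDist g Δg δg := ⟨hgm, hgb, hgd, hgl.nonneg, hgl.le⟩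
  -- endpoints are `≥ n − 2` apart
  have hL₀ : ∀ x ∈ Δf, ∀ z ∈ Δg, ∀ a ∈ linkEnds x, ∀ w ∈ linkEnds z, n - 2 ≤ torusNorm (a - w) := by
    intro x hx z hz a ha w hw
    have h2 := hdist x hx z hz
    have htri : torusNorm (x.1 - z.1) ≤ 1 + torusNorm (a - w) + 1 := by
      calc torusNorm (x.1 - z.1) ≤ torusNorm (x.1 - a) + torusNorm (a - z.1) := torusNorm_sub_le _ _ _
        _ ≤ torusNorm (x.1 - a) + (torusNorm (a - w) + torusNorm (w - z.1)) :=
            Nat.add_le_add_left (torusNorm_sub_le _ _ _) _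
        _ ≤ 1 + (torusNorm (a - w) + 1) := by
            refine Nat.add_le_add (torusNorm_fst_sub_linkEnds_le_one _ ha) (Nat.add_le_add_left ?_ _)
            rw [← torusNorm_neg, neg_sub]; exact torusNorm_fst_sub_linkEnds_le_one _ hw
        _ = 1 + torusNorm (a - w) + 1 := by ring
    omega
  have key := StarDimRows.abs_covariance_le_of_oneLinkKRModulus hd hL hN hK0 hR hmod h₀ hf hg (n - 2) hL₀
  -- compare the rates and absorb the `2` lost steps
  have hS1 : 0 ≤ ∑ x ∈ Δf, δf x := sum_nonneg fun x _ => hfl.nonneg x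
  have hS2 : 0 ≤ ∑ y ∈ Δg, δg y := sum_nonneg fun y _ => hgl.nonneg y
  have hn2 : (n : ℝ) - 2 ≤ ((n - 2 : ℕ) : ℝ) := by
    rcases le_or_gt 2 n with h2 | h2
    · rw [Nat.cast_sub h2]; push_cast; exact le_rfl
    · have : ((n - 2 : ℕ) : ℝ) = 0 := by rw [Nat.sub_eq_zero_of_le h2.le]; simp
      rw [this]
      have : (n : ℝ) < 2 := by exact_mod_cast h2
      linarith
  have hexp : Real.exp (-(m₀ * ((n - 2 : ℕ) : ℝ))) ≤ Real.exp (2 * m) * Real.exp (-m * n) := by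
    rw [← Real.exp_add]
    refine Real.exp_le_exp.2 ?_
    have : m * ((n - 2 : ℕ) : ℝ) ≤ m₀ * ((n - 2 : ℕ) : ℝ) :=
      mul_le_mul_of_nonneg_right hmle (Nat.cast_nonneg _)
    nlinarith [mul_le_mul_of_nonneg_left hn2 hm0]
  have hsq : 4 * (2 * Real.sqrt N) ^ 2 = 16 * (N : ℝ) := by
    rw [mul_pow, Real.sq_sqrt (Nat.cast_nonneg N)]; ring
  rw [hsq] at key
  have h16 : (0 : ℝ) ≤ 16 * N := by positivity
  calc |cov[f, g; wilsonMeasure (d := d) (L := L) (fundamentalRep (Fin N)) β]|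
      ≤ 16 * (N : ℝ) * Real.exp (-(m₀ * ((n - 2 : ℕ) : ℝ))) * (∑ x ∈ Δf, δf x) * ∑ y ∈ Δg, δg y := key
    _ ≤ 16 * (N : ℝ) * (Real.exp (2 * m) * Real.exp (-m * n)) * (∑ x ∈ Δf, δf x) * ∑ y ∈ Δg, δg y := by
        gcongr
    _ = 16 * N * Real.exp (2 * m) * (∑ x ∈ Δf, δf x) * (∑ y ∈ Δg, δg y) * Real.exp (-m * n) := by ring

end Torus

/-- **`UniformClustering` for the torus Wilson family from a one-link modulus, every dimension `d`**:
under the hypotheses of `clustersWith_wilson_of_oneLinkKRModulus` (which do not mention the side), ONE constant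
`16 N e^{2m̄}` and ONE rate `m̄` serve every torus of side `M ≥ 3`. [folklore] -/
theorem uniformClustering_wilson_of_oneLinkKRModulus (hd : 2 ≤ d) (hN : 1 ≤ N) {β R K c : ℝ}
    (hK0 : 0 ≤ K) (hR : |β| / N * (2 * ((d : ℝ) - 1)) ≤ R) (hmod : OneLinkKRModulus N R K)
    (hc : K * (|β| / N) ≤ c) (h : doorPoly d c < 1) :
    YM3IR.UniformClustering suFrobDist
      (fun M _ => wilsonMeasure (d := d) (L := M) (fundamentalRep (Fin N)) β)
      ((1 - gaugeR d c) ^ 2 / (2 * (2 * gaugeR d c * ((2 * d : ℕ) : ℝ) + 1))) :=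
  ⟨_, fun _ _ hM => clustersWith_wilson_of_oneLinkKRModulus hd hM hN hK0 hR hmod hc h⟩

/-! ### Every `SU(N)`, `N ≥ 2`, every `d ≥ 2`: the Bakry–Émery modulus, hypothesis-free -/

/-- **`SU(N)`, EVERY `N ≥ 2`, EVERY `d ≥ 2`, HYPOTHESIS-FREE, TWO-SIDED**: at every tree coupling with
`(d−1)|β|/N ≤ 1/12` the torus Wilson laws of `SU(N)` cluster exponentially, uniformly in the side `M ≥ 3`, in
the Y4 currency, with the closed-form rate `κ_d(R_G^{(d)}(1/(4(d−1))))` (Bakry–Émery modulus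
`K = 1/(1/2 − 2(d−1)|β|/N) ≤ 3`, `c ≤ 3|β|/N ≤ 1/(4(d−1))`, and `P_d(1/(4(d−1))) = 1/(4(d−1)) + (4d−6)/(4(d−1))
< 1`). Same window as `StarDimMassGap.massGapAt_SU_of_abs_le` / `StarDimRows.unique_SU_of_abs_le`. [folklore] -/
theorem uniformClustering_wilson_SU_of_abs_le (hd : 2 ≤ d) (hN : 2 ≤ N) {β : ℝ}
    (hβ : |β| / N * ((d : ℝ) - 1) ≤ 1 / 12) :
    YM3IR.UniformClustering suFrobDist
      (fun M _ => wilsonMeasure (d := d) (L := M) (fundamentalRep (Fin N)) β)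
      ((1 - gaugeR d (1 / (4 * ((d : ℝ) - 1)))) ^ 2 /
        (2 * (2 * gaugeR d (1 / (4 * ((d : ℝ) - 1))) * ((2 * d : ℕ) : ℝ) + 1))) := by
  have hd' : (2 : ℝ) ≤ d := by exact_mod_cast hd
  have hd1 : (0 : ℝ) < (d : ℝ) - 1 := by linarith
  have hx0 : 0 ≤ |β| / N := by positivity
  have hu : |β| / N * (2 * ((d : ℝ) - 1)) ≤ 1 / 6 := by nlinarith
  have hx : |β| / N * (2 * ((d : ℝ) - 1)) < 1 / 2 := by linarith
  have hpos : (0 : ℝ) < 1 / 2 - |β| / N * (2 * ((d : ℝ) - 1)) := by linarith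
  have hK0 : 0 ≤ 1 / (1 / 2 - |β| / N * (2 * ((d : ℝ) - 1))) := (one_div_pos.2 hpos).le
  have hK3 : 1 / (1 / 2 - |β| / N * (2 * ((d : ℝ) - 1))) ≤ 3 := by rw [div_le_iff₀ hpos]; linarith
  refine uniformClustering_wilson_of_oneLinkKRModulus hd (by omega) hK0 le_rfl (oneLinkKRModulus_SU hN hx) ?_ ?_
  · -- `K|β|/N ≤ 3|β|/N ≤ 1/(4(d−1))`
    calc 1 / (1 / 2 - |β| / N * (2 * ((d : ℝ) - 1))) * (|β| / N) ≤ 3 * (|β| / N) :=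
          mul_le_mul_of_nonneg_right hK3 hx0
      _ ≤ 1 / (4 * ((d : ℝ) - 1)) := by rw [le_div_iff₀ (by positivity)]; nlinarith
  · -- the door at `1/(4(d−1))`: `P_d = (4d−4)/(16(d−1)²) + (4d−6)/(4(d−1)) = (4d−5)/(4(d−1)) < 1`
    unfold doorPoly
    have hne : (d : ℝ) - 1 ≠ 0 := hd1.ne'
    have e : (4 * (d : ℝ) - 4) * (1 / (4 * ((d : ℝ) - 1))) ^ 2 + (4 * (d : ℝ) - 6) * (1 / (4 * ((d : ℝ) - 1)))
        = (4 * (d : ℝ) - 5) / (4 * ((d : ℝ) - 1)) := by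
      field_simp; ring
    rw [e, div_lt_one (by positivity)]
    linarith

/-! ### `d = 3`, in track Y4's vocabulary `wilsonFamily3` -/

/-- **THE STRONG-COUPLING END OF THE YM₃ CURRENCY, EVERY `SU(N)`, `N ≥ 2`, HYPOTHESIS-FREE, TWO-SIDED**:
at every tree coupling `|β| ≤ 2N/45` ('t Hooft `|β|/N ≤ 2/45 = 0.0444`, the all-`N` `d = 3` star row of
`StarMassGapDimRows`; Wilson `|β_W| ≤ 2N²/45`) the `d = 3` Wilson laws `wilsonFamily3 (fundamentalRep (Fin N)) β`
satisfy `YM3IR.UniformClustering suFrobDist _ m₃` with the explicit rate `m₃ = κ_3(R_G^{(3)}(4/29))`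
(`R_G^{(3)}(4/29) = 528/545`; `m₃ > 0`, `uniformClustering_wilsonFamily3_SU_rate_pos`).  This is the case
the docstring of `YM3IR.LatticeMassGap3` records as «known IN PRINT only at strong coupling» — now kernel-checked;
it does not touch the weak-coupling targets. [folklore] -/
theorem uniformClustering_wilsonFamily3_SU (hN : 2 ≤ N) {β : ℝ} (hβ : |β| ≤ 2 * N / 45) :
    YM3IR.UniformClustering suFrobDist (YM3IR.wilsonFamily3 (fundamentalRep (Fin N)) β)
      ((1 - gaugeR 3 (4 / 29)) ^ 2 / (2 * (2 * gaugeR 3 (4 / 29) * ((2 * 3 : ℕ) : ℝ) + 1))) := by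
  have hN0 : (0 : ℝ) < N := by exact_mod_cast (show 0 < N by omega)
  have hx : |β| / N ≤ 2 / 45 := by rw [div_le_iff₀ hN0]; linarith
  have hx0 : 0 ≤ |β| / N := by positivity
  have hxR : |β| / N * (2 * (((3 : ℕ) : ℝ) - 1)) < 1 / 2 := by push_cast; linarith
  have hpos : 0 < 1 / 2 - |β| / N * (2 * (((3 : ℕ) : ℝ) - 1)) := by linarith
  have hK0 : 0 ≤ 1 / (1 / 2 - |β| / N * (2 * (((3 : ℕ) : ℝ) - 1))) := (one_div_pos.2 hpos).le
  have hc : 1 / (1 / 2 - |β| / N * (2 * (((3 : ℕ) : ℝ) - 1))) * (|β| / N) ≤ 4 / 29 := by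
    rw [one_div_mul_eq_div, div_le_iff₀ hpos]
    push_cast
    linarith
  exact uniformClustering_wilson_of_oneLinkKRModulus (d := 3) (by norm_num) (by omega) hK0 le_rfl
    (oneLinkKRModulus_SU hN hxR) hc (by unfold doorPoly; norm_num)

/-- The rate of `uniformClustering_wilsonFamily3_SU` is positive (`R_G^{(3)}(4/29) = 528/545 < 1`), so the
statement is a genuine exponential clustering, not a vacuous one. [folklore] -/
theorem uniformClustering_wilsonFamily3_SU_rate_pos :
    0 < (1 - gaugeR 3 (4 / 29)) ^ 2 / (2 * (2 * gaugeR 3 (4 / 29) * ((2 * 3 : ℕ) : ℝ) + 1)) := by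
  have e : gaugeR 3 (4 / 29) = 528 / 545 := by unfold gaugeR Delta; norm_num
  rw [e]; norm_num

/-- **`SU(2)` on `(ℤ/M)³`, two-sided, hypothesis-free**: at every tree coupling `|β| ≤ 5/18` (Wilson
`|β_W| = 2|β| ≤ 5/9`, the `SU(2)` `d = 3` row of `StarMassGapDimRows`; quarter modulus `OneLinkKRModulus 2 (3/4) 1`,
the tilt `2(d−1)|β|/2 = 2|β| ≤ 5/9` being inside the ball `3/4`) the `d = 3` Wilson laws satisfy
`YM3IR.UniformClustering suFrobDist _ m` with `m = κ_3(R_G^{(3)}(5/36))` (`R_G^{(3)}(5/36) = 205/209`). [folklore] -/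
theorem uniformClustering_wilsonFamily3_SU2 {β : ℝ} (hβ : |β| ≤ 5 / 18) :
    YM3IR.UniformClustering suFrobDist (YM3IR.wilsonFamily3 (fundamentalRep (Fin 2)) β)
      ((1 - gaugeR 3 (5 / 36)) ^ 2 / (2 * (2 * gaugeR 3 (5 / 36) * ((2 * 3 : ℕ) : ℝ) + 1))) := by
  have hmod : OneLinkKRModulus 2 (3 / 4) 1 := by
    have hm := Summit.Ventures.YMGap.QuarterModulusOneHalf.oneLinkKRModulusSU2_of_le_oneHalf
      (βW := 1 / 2) le_rfl
    unfold Balaban1983to89.StrongCouplingDobrushinWindow.OneLinkKRModulusSU2 at hm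
    norm_num at hm
    exact hm
  have hR : |β| / (2 : ℕ) * (2 * (((3 : ℕ) : ℝ) - 1)) ≤ 3 / 4 := by push_cast; linarith
  have hc : 1 * (|β| / (2 : ℕ)) ≤ 5 / 36 := by push_cast; linarith
  exact uniformClustering_wilson_of_oneLinkKRModulus (d := 3) (N := 2) (by norm_num) (by norm_num) zero_le_one
    hR hmod hc (by unfold doorPoly; norm_num)

/-- The `SU(2)` rate is positive (`R_G^{(3)}(5/36) = 205/209 < 1`). [folklore] -/
theorem uniformClustering_wilsonFamily3_SU2_rate_pos :
    0 < (1 - gaugeR 3 (5 / 36)) ^ 2 / (2 * (2 * gaugeR 3 (5 / 36) * ((2 * 3 : ℕ) : ℝ) + 1)) := by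
  have e : gaugeR 3 (5 / 36) = 205 / 209 := by unfold gaugeR Delta; norm_num
  rw [e]; norm_num

/-- **Packaged form for the Y4 statement files**: every `SU(N)`, `N ≥ 2`, `d = 3`, `|β| ≤ 2N/45` —
`∃ m > 0, UniformClustering suFrobDist (wilsonFamily3 (fundamentalRep (Fin N)) β) m`. [folklore] -/
theorem exists_uniformClustering_wilsonFamily3_SU (hN : 2 ≤ N) {β : ℝ} (hβ : |β| ≤ 2 * N / 45) :
    ∃ m : ℝ, 0 < m ∧ YM3IR.UniformClustering suFrobDist (YM3IR.wilsonFamily3 (fundamentalRep (Fin N)) β) m :=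
  ⟨_, uniformClustering_wilsonFamily3_SU_rate_pos, uniformClustering_wilsonFamily3_SU hN hβ⟩

end Summit.Ventures.YMGap.YM3IR.StrongCoupling

end
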